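import Literature.Analysis.FluidPDE.DynamicRescalingRate
import Literature.Analysis.FluidPDE.NSLerayBlowupRateTopHolds
import HarnessLib

/-!
# The length and velocity clocks of a dynamic rescaling with DRIFTING exponents whose ratio is
# pinned above Leray's `½`, and what Leray's necessary blow-up rate then says

Topic `Literature/Analysis/FluidPDE`; companion of `DynamicRescalingRate.lean` (the VORTICITY
clock `C_ω ≍ T − t` of a one-exponent rescaling) and of the EXACT-ansatz bookkeeping of
`SelfSimilarCollapseAnsatz.lean` (`not_frequently_leray_lower_bound_of_half_lt`,
`isTypeIBlowup_selfSimilarCollapse`, for a CONSTANT collapse exponent `γ`). Here the two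
exponents are functions of the rescaled time and only their RATIO is pinned; nothing is specific
to a fluid equation until the last section, which composes the bookkeeping with the KERNEL
theorem ns.S28 of the tree (Leray's necessary blow-up rate, `leray_blowup_rate_top_holds`).
The circulation clock and the rescaled viscosity are in `DynamicRescalingCirculationClock.lean`.

## The dictionary (Hou 2026 §3, pp. 10–11 of the held text; Chen–Hou CMP 2021 §4.1 (4.1)–(4.3))

Hou's dynamic rescaling of (generalized) axisymmetric Navier–Stokes in the Hou–Li variables is
`ũ₁(τ, ξ, η) = C_u(τ) u₁(t(τ), C_l(τ)ξ, C_l(τ)η)` with `C_u(τ) = exp ∫₀^τ c_u`,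
`C_l(τ) = exp(−∫₀^τ c_l)` and `t(τ) = ∫₀^τ C_ψ C_l = ∫₀^τ C_u` (`c_ψ = c_u + c_l`, so
`C_ψ C_l = C_u`: the TIME clock is `C_u`, `t′(τ) = C_u(τ)`). In the tree's vocabulary
(`DynamicRescalingBlowup.lean`): `C_u = rescalingFactor c_u`, `C_l = rescalingFactor (−c_l)`,
`t = rescaledTime C_u`, `T = t(∞) = blowupTime C_u`. The physical velocity is
`u = (u^r, r u₁, u^z)` and `ũ^ξ = (C_u/C_l) u^r`, `ξ ũ₁ = (C_u/C_l) r u₁`, `ũ^η = (C_u/C_l) u^z`,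
so the RESCALED SPEED is `|ũ| = (C_u/C_l) |u|`. For CONSTANT exponents Hou prints
`1/C_u = 1/(T − t)`, `C_l = (T − t)^{ĉ_l}`, `ĉ_l = c_l/(c_l − c_ψ) = c_l/|c_u|` (p. 10).

## What is proved (all `theorem`s; no definitions, no named facts)

Exponents `c_u, c_l : ℝ → ℝ` continuous; "pinned clock" means `−b ≤ c_u ≤ −a < 0` on `[0, ∞)`
(then `a (T − t(τ)) ≤ C_u(τ) ≤ b (T − t(τ))`, `rescalingFactor_mem_Icc`); "ratio pinned above
`γ`" means `γ (−c_u(s)) ≤ c_l(s)` for `s ≥ 0` (`ĉ_l(s) ≥ γ`), "below `γ′`" the reverse.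

* LENGTH CLOCK: ratio `≥ γ` ⇒ `C_l(τ) ≤ C_u(τ)^γ ≤ (b (T − t(τ)))^γ`; ratio `≤ γ′` ⇒
  `C_u(τ)^{γ′} ≤ C_l(τ)`; ratio `≡ γ` ⇒ `C_l = C_u^γ` (Hou's `C_l = (T−t)^{ĉ_l}` at `C_u = T−t`)
  (`lengthFactor_le_rpow_clockFactor`, `rpow_clockFactor_le_lengthFactor`,
  `lengthFactor_eq_rpow_clockFactor`, `lengthFactor_le_rpow_sub_rescaledTime`).
* SUB-LERAY SPEED: ratio `≥ γ ≥ ½`, pinned clock, and a nonnegative size functional with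
  BOUNDED rescaled profile in the velocity normalisation, `(C_u/C_l)(τ) F(t(τ), x) ≤ M`
  (`‖ũ(τ)‖_∞ ≤ M` for `F = |u|`) ⇒ `F(s, x) ≤ M b^{γ−½} a^{−½} (T − s)^{γ−1}` on `[0, T)` and
  `√(T − s) F(s, x) ≤ M b^{γ−½} a^{−½} (T − s)^{γ−½}`; for `γ > ½` the Type-I quantity tends to
  zero, `∀ ε > 0, ∀ᶠ s ↑ T, ∀ x, √(T−s) F(s,x) ≤ ε` (`speed_le_mul_rpow_clockFactor`,
  `speed_le_of_rescaling`, `sqrt_mul_speed_le_of_rescaling`,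
  `eventually_sqrt_mul_speed_le_of_rescaling`).
* LERAY'S RATE EXCLUDES THE SUB-LERAY SIDE (composition with ns.S28): no maximal smooth
  Leray–Hopf solution of Navier–Stokes (`ν > 0`, no force) with lifespan `T = t(∞)` is carried
  by such a rescaling with ratio pinned `≥ γ > ½` and bounded rescaled speed
  (`not_isMaximalSmoothSolution_of_rescaling_of_half_lt`).

## Why (the `ns-blowup` profile census, zone Z5; CENSUS-HOOKS-Z5-Z8 H1/H3 vs H6)

The kernel census hooks are statements about EXACT self-similar collapses; a dynamic-rescaling
computation reports a DRIFTING fit `ĉ_l(τ) = c_l(τ)/|c_u(τ)|` (e.g. pinned inside `(½, 1)` over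
decades of vorticity amplification, with bounded rescaled speed). The theorems here are the hooks
for that object: persisting `ĉ_l ≥ γ > ½` with bounded `‖ũ‖_∞` to the end of the clock is NOT a
Navier–Stokes blow-up at `t(∞)` — along such a clock either the rescaled speed becomes unbounded,
or the ratio is not eventually pinned above any `γ > ½`, or `t(∞)` is not the lifespan.

## WHAT THIS IS NOT
Real-variable bookkeeping plus one composition with a kernel theorem; no profile is constructed,
no existence or blow-up is asserted, nothing is claimed about any computed trajectory.
-/

noncomputable section

open MeasureTheory Set Filter Function intervalIntegral
open _root_.Topology
open scoped ENNReal

namespace Literature.Analysis.FluidPDE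

/-! ### The length clock against the time clock -/

section LengthClock

variable {cu cl : ℝ → ℝ}

/-- **Length clock, upper side.** If the ratio is pinned above `γ`, `γ (−c_u(s)) ≤ c_l(s)` for
`s ≥ 0` (`ĉ_l ≥ γ`), then `C_l(τ) = exp(−∫₀^τ c_l) ≤ (exp ∫₀^τ c_u)^γ = C_u(τ)^γ` for `τ ≥ 0`
(monotonicity of the integral; Hou's `C_l = (T−t)^{ĉ_l}`, `C_u = T − t` is the constant case).
[cite: Hou2026, §3 (dynamic rescaling formulation; scaling formulas for C_u, C_l)] -/
theorem lengthFactor_le_rpow_clockFactor (hcu : Continuous cu) (hcl : Continuous cl) {γ : ℝ}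
    (hratio : ∀ s, 0 ≤ s → γ * (-cu s) ≤ cl s) {τ : ℝ} (hτ : 0 ≤ τ) :
    rescalingFactor (fun s => -cl s) τ ≤ rescalingFactor cu τ ^ γ := by
  unfold rescalingFactor
  rw [← Real.exp_mul, Real.exp_le_exp, mul_comm, ← intervalIntegral.integral_const_mul]
  exact intervalIntegral.integral_mono_on hτ (hcl.neg.intervalIntegrable _ _)
    ((continuous_const.mul hcu).intervalIntegrable _ _) fun s hs => by
      have h := hratio s hs.1
      linarith

/-- **Length clock, lower side.** If the ratio is pinned below `γ′`, `c_l(s) ≤ γ′ (−c_u(s))` for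
`s ≥ 0` (`ĉ_l ≤ γ′`), then `C_u(τ)^{γ′} ≤ C_l(τ)` for `τ ≥ 0`.
[cite: Hou2026, §3 (dynamic rescaling formulation; scaling formulas for C_u, C_l)] -/
theorem rpow_clockFactor_le_lengthFactor (hcu : Continuous cu) (hcl : Continuous cl) {γ' : ℝ}
    (hratio : ∀ s, 0 ≤ s → cl s ≤ γ' * (-cu s)) {τ : ℝ} (hτ : 0 ≤ τ) :
    rescalingFactor cu τ ^ γ' ≤ rescalingFactor (fun s => -cl s) τ := by
  unfold rescalingFactor
  rw [← Real.exp_mul, Real.exp_le_exp, mul_comm, ← intervalIntegral.integral_const_mul]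
  exact intervalIntegral.integral_mono_on hτ ((continuous_const.mul hcu).intervalIntegrable _ _)
    (hcl.neg.intervalIntegrable _ _) fun s hs => by
      have h := hratio s hs.1
      linarith

/-- **Constant ratio.** If `c_l = γ (−c_u)` identically (`ĉ_l ≡ γ`), then `C_l = C_u^γ` exactly —
Hou's `C_l = (T−t)^{ĉ_l}` in the normalisation `C_u = T − t`.
[cite: Hou2026, §3 (scaling formulas C_lz = (T−t)^{ĉ_lz}, 1/C_u = 1/(T−t))] -/
theorem lengthFactor_eq_rpow_clockFactor {γ : ℝ} (hratio : ∀ s, cl s = γ * (-cu s)) (τ : ℝ) :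
    rescalingFactor (fun s => -cl s) τ = rescalingFactor cu τ ^ γ := by
  unfold rescalingFactor
  rw [← Real.exp_mul, mul_comm, ← intervalIntegral.integral_const_mul]
  congr 1
  refine intervalIntegral.integral_congr fun s _ => ?_
  simp only [hratio, mul_neg, neg_neg]

/-- **Length clock against the physical clock.** With the time clock pinned, `−b ≤ c_u ≤ −a < 0` on
`[0, ∞)`, and the ratio pinned above `γ ≥ 0`: `C_l(τ) ≤ (b (T − t(τ)))^γ` for `τ ≥ 0`, where
`t = rescaledTime C_u`, `T = blowupTime C_u` (the length scale collapses at least like `(T−t)^γ`).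
[cite: Hou2026, §3 (scaling formulas C_lz = (T−t)^{ĉ_lz}, 1/C_u = 1/(T−t))] -/
theorem lengthFactor_le_rpow_sub_rescaledTime (hcu : Continuous cu) (hcl : Continuous cl)
    {a b : ℝ} (ha : 0 < a) (hca : ∀ s, 0 ≤ s → cu s ≤ -a) (hcb : ∀ s, 0 ≤ s → -b ≤ cu s)
    {γ : ℝ} (hγ : 0 ≤ γ) (hratio : ∀ s, 0 ≤ s → γ * (-cu s) ≤ cl s) {τ : ℝ} (hτ : 0 ≤ τ) :
    rescalingFactor (fun s => -cl s) τ ≤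
      (b * (blowupTime (rescalingFactor cu) - rescaledTime (rescalingFactor cu) τ)) ^ γ :=
  (lengthFactor_le_rpow_clockFactor hcu hcl hratio hτ).trans
    (Real.rpow_le_rpow (rescalingFactor_pos cu τ).le
      (rescalingFactor_le_mul_sub_rescaledTime hcu ha hca hcb hτ) hγ)

end LengthClock

/-! ### The velocity clock: sub-Leray speed for a ratio pinned above `½` -/

section Speed

variable {cu cl : ℝ → ℝ} {X : Type*} {F : ℝ → X → ℝ} {M : ℝ}

/-- **Speed at rescaled times.** If the ratio is pinned above `γ` and the rescaled profile of a
nonnegative size functional `F` is bounded in the VELOCITY normalisation,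
`(C_u/C_l)(τ) F(t(τ), x) ≤ M` for `τ ≥ 0` (for `F = |u|` this is `‖ũ(τ)‖_∞ ≤ M`,
`ũ = (C_u/C_l) u(t(τ), C_l ·)`), then `F(t(τ), x) ≤ M C_u(τ)^{γ−1}`.
[cite: Hou2026, §3 (rescaled profiles ũ₁ = C_u u₁(t(τ), C_l ξ, C_l η); scaling formulas)] -/
theorem speed_le_mul_rpow_clockFactor (hcu : Continuous cu) (hcl : Continuous cl) {γ : ℝ}
    (hratio : ∀ s, 0 ≤ s → γ * (-cu s) ≤ cl s) (hF0 : ∀ s x, 0 ≤ F s x)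
    (hF : ∀ τ, 0 ≤ τ → ∀ x, rescalingFactor cu τ / rescalingFactor (fun s => -cl s) τ *
      F (rescaledTime (rescalingFactor cu) τ) x ≤ M)
    {τ : ℝ} (hτ : 0 ≤ τ) (x : X) :
    F (rescaledTime (rescalingFactor cu) τ) x ≤ M * rescalingFactor cu τ ^ (γ - 1) := by
  have hCu := rescalingFactor_pos cu τ
  have hCl := rescalingFactor_pos (fun s => -cl s) τ
  have h1 := hF τ hτ x
  have h0 := hF0 (rescaledTime (rescalingFactor cu) τ) x
  have hM : 0 ≤ M := le_trans (mul_nonneg (div_pos hCu hCl).le h0) h1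
  -- `F ≤ M · C_l / C_u`
  have h2 : F (rescaledTime (rescalingFactor cu) τ) x ≤
      M * (rescalingFactor (fun s => -cl s) τ / rescalingFactor cu τ) := by
    rw [div_mul_eq_mul_div, div_le_iff₀ hCl] at h1
    rw [← mul_div_assoc, le_div_iff₀ hCu]
    linarith
  -- `C_l / C_u ≤ C_u^γ / C_u = C_u^{γ−1}`
  have h3 : rescalingFactor (fun s => -cl s) τ / rescalingFactor cu τ ≤
      rescalingFactor cu τ ^ (γ - 1) := by
    rw [Real.rpow_sub hCu, Real.rpow_one]
    exact div_le_div_of_nonneg_right (lengthFactor_le_rpow_clockFactor hcu hcl hratio hτ) hCu.le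
  exact h2.trans (mul_le_mul_of_nonneg_left h3 hM)

/-- **Sub-Leray envelope in physical time.** With the time clock pinned (`−b ≤ c_u ≤ −a < 0` on
`[0, ∞)`), the ratio pinned above `γ ≥ ½` and bounded rescaled speed `(C_u/C_l) F(t(τ), ·) ≤ M`:
for every `s ∈ [0, T)` and every `x`, `F(s, x) ≤ M b^{γ−½} a^{−½} (T − s)^{γ−1}` — the physical speed
is bounded by the `(T−s)^{γ−1}` envelope of the exact ansatz with exponent `γ`
(`norm_selfSimilarCollapse_le`), although the exponents themselves drift.
[cite: Hou2026, §3 (scaling formulas 1/C_u = 1/(T−t), C_lz = (T−t)^{ĉ_lz})] -/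
theorem speed_le_of_rescaling (hcu : Continuous cu) (hcl : Continuous cl) {a b : ℝ} (ha : 0 < a)
    (hca : ∀ s, 0 ≤ s → cu s ≤ -a) (hcb : ∀ s, 0 ≤ s → -b ≤ cu s) {γ : ℝ} (hγ : 1 / 2 ≤ γ)
    (hratio : ∀ s, 0 ≤ s → γ * (-cu s) ≤ cl s) (hF0 : ∀ s x, 0 ≤ F s x)
    (hF : ∀ τ, 0 ≤ τ → ∀ x, rescalingFactor cu τ / rescalingFactor (fun s => -cl s) τ *
      F (rescaledTime (rescalingFactor cu) τ) x ≤ M)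
    {s : ℝ} (hs : s ∈ Ico 0 (blowupTime (rescalingFactor cu))) (x : X) :
    F s x ≤ M * (b ^ (γ - 1 / 2) * a ^ (-(1 / 2 : ℝ))) *
      (blowupTime (rescalingFactor cu) - s) ^ (γ - 1) := by
  obtain ⟨τ, hτ, rfl⟩ := exists_rescaledTime_eq_of_mem_Ico (continuous_rescalingFactor hcu)
    (integrableOn_rescalingFactor hcu ha hca) hs
  have hCu := rescalingFactor_pos cu τ
  have hlow := mul_sub_rescaledTime_le_rescalingFactor hcu ha hca hτ
  have hup := rescalingFactor_le_mul_sub_rescaledTime hcu ha hca hcb hτ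
  have hTt : 0 < blowupTime (rescalingFactor cu) - rescaledTime (rescalingFactor cu) τ :=
    sub_pos.2 (rescaledTime_lt_blowupTime (continuous_rescalingFactor hcu) (rescalingFactor_pos cu)
      (integrableOn_rescalingFactor hcu ha hca) τ)
  have haT : 0 < a * (blowupTime (rescalingFactor cu) - rescaledTime (rescalingFactor cu) τ) :=
    mul_pos ha hTt
  have hb : 0 < b := by
    have : 0 < b * (blowupTime (rescalingFactor cu) - rescaledTime (rescalingFactor cu) τ) :=
      hCu.trans_le hup
    exact pos_of_mul_pos_left this hTt.le  -- `0 < b * d`, `0 ≤ d` ⇒ `0 < b`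
  have h1 := speed_le_mul_rpow_clockFactor hcu hcl hratio hF0 hF hτ x
  have hM : 0 ≤ M := by
    have h0 := hF0 (rescaledTime (rescalingFactor cu) τ) x
    have := hF τ hτ x
    exact le_trans (mul_nonneg (div_pos hCu (rescalingFactor_pos _ τ)).le h0) this
  -- split `C_u^{γ−1} = C_u^{γ−½} · C_u^{−½}` and compare each factor with the clock
  have hsplit : rescalingFactor cu τ ^ (γ - 1) =
      rescalingFactor cu τ ^ (γ - 1 / 2) * rescalingFactor cu τ ^ (-(1 / 2 : ℝ)) := by
    rw [← Real.rpow_add hCu]; congr 1; ring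
  have hA : rescalingFactor cu τ ^ (γ - 1 / 2) ≤
      (b * (blowupTime (rescalingFactor cu) - rescaledTime (rescalingFactor cu) τ)) ^ (γ - 1 / 2) :=
    Real.rpow_le_rpow hCu.le hup (by linarith)
  have hB : rescalingFactor cu τ ^ (-(1 / 2 : ℝ)) ≤
      (a * (blowupTime (rescalingFactor cu) - rescaledTime (rescalingFactor cu) τ)) ^ (-(1 / 2 : ℝ)) :=
    Real.rpow_le_rpow_of_nonpos haT hlow (by norm_num)
  have hprod : rescalingFactor cu τ ^ (γ - 1) ≤
      (b ^ (γ - 1 / 2) * a ^ (-(1 / 2 : ℝ))) *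
        (blowupTime (rescalingFactor cu) - rescaledTime (rescalingFactor cu) τ) ^ (γ - 1) := by
    rw [hsplit]
    calc rescalingFactor cu τ ^ (γ - 1 / 2) * rescalingFactor cu τ ^ (-(1 / 2 : ℝ))
        ≤ (b * (blowupTime (rescalingFactor cu) - rescaledTime (rescalingFactor cu) τ)) ^ (γ - 1 / 2) *
          (a * (blowupTime (rescalingFactor cu) - rescaledTime (rescalingFactor cu) τ)) ^
            (-(1 / 2 : ℝ)) :=
          mul_le_mul hA hB (Real.rpow_nonneg hCu.le _) (Real.rpow_nonneg (mul_pos hb hTt).le _)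
      _ = (b ^ (γ - 1 / 2) * a ^ (-(1 / 2 : ℝ))) *
          (blowupTime (rescalingFactor cu) - rescaledTime (rescalingFactor cu) τ) ^ (γ - 1) := by
          rw [Real.mul_rpow hb.le hTt.le, Real.mul_rpow ha.le hTt.le,
            show γ - 1 = (γ - 1 / 2) + (-(1 / 2 : ℝ)) by ring, Real.rpow_add hTt]
          ring
  exact h1.trans (by
    have := mul_le_mul_of_nonneg_left hprod hM
    simpa only [mul_assoc] using this)

/-- **The Type-I quantity along the clock.** Under the hypotheses of `speed_le_of_rescaling`:
`√(T − s) F(s, x) ≤ M b^{γ−½} a^{−½} (T − s)^{γ−½}` for `s ∈ [0, T)`.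
[cite: Hou2026, §3 (scaling formulas 1/C_u = 1/(T−t), C_lz = (T−t)^{ĉ_lz})] -/
theorem sqrt_mul_speed_le_of_rescaling (hcu : Continuous cu) (hcl : Continuous cl) {a b : ℝ}
    (ha : 0 < a) (hca : ∀ s, 0 ≤ s → cu s ≤ -a) (hcb : ∀ s, 0 ≤ s → -b ≤ cu s) {γ : ℝ}
    (hγ : 1 / 2 ≤ γ) (hratio : ∀ s, 0 ≤ s → γ * (-cu s) ≤ cl s) (hF0 : ∀ s x, 0 ≤ F s x)
    (hF : ∀ τ, 0 ≤ τ → ∀ x, rescalingFactor cu τ / rescalingFactor (fun s => -cl s) τ *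
      F (rescaledTime (rescalingFactor cu) τ) x ≤ M)
    {s : ℝ} (hs : s ∈ Ico 0 (blowupTime (rescalingFactor cu))) (x : X) :
    Real.sqrt (blowupTime (rescalingFactor cu) - s) * F s x ≤
      M * (b ^ (γ - 1 / 2) * a ^ (-(1 / 2 : ℝ))) *
        (blowupTime (rescalingFactor cu) - s) ^ (γ - 1 / 2) := by
  have hTs : 0 < blowupTime (rescalingFactor cu) - s := sub_pos.2 hs.2
  have h := speed_le_of_rescaling hcu hcl ha hca hcb hγ hratio hF0 hF hs x
  have hsq : 0 ≤ Real.sqrt (blowupTime (rescalingFactor cu) - s) := Real.sqrt_nonneg _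
  calc Real.sqrt (blowupTime (rescalingFactor cu) - s) * F s x
      ≤ Real.sqrt (blowupTime (rescalingFactor cu) - s) *
          (M * (b ^ (γ - 1 / 2) * a ^ (-(1 / 2 : ℝ))) *
            (blowupTime (rescalingFactor cu) - s) ^ (γ - 1)) := mul_le_mul_of_nonneg_left h hsq
    _ = M * (b ^ (γ - 1 / 2) * a ^ (-(1 / 2 : ℝ))) *
          (blowupTime (rescalingFactor cu) - s) ^ (γ - 1 / 2) := by
        rw [Real.sqrt_eq_rpow, show γ - 1 / 2 = 1 / 2 + (γ - 1) by ring, Real.rpow_add hTs]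
        ring

/-- For `γ > ½`, `(T − s)^{γ − ½} → 0` as `s ↑ T`. [folklore] -/
private theorem tendsto_rpow_sub_nhdsLT {T γ : ℝ} (hγ : 1 / 2 < γ) :
    Tendsto (fun s => (T - s) ^ (γ - 1 / 2)) (𝓝[<] T) (𝓝 0) := by
  have h1 : Tendsto (fun s : ℝ => T - s) (𝓝[<] T) (𝓝 0) := by
    have : Tendsto (fun s : ℝ => T - s) (𝓝 T) (𝓝 (T - T)) :=
      (continuous_const.sub continuous_id).tendsto T
    rw [sub_self] at this
    exact this.mono_left nhdsWithin_le_nhds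
  have h2 : ContinuousAt (fun r : ℝ => r ^ (γ - 1 / 2)) 0 :=
    Real.continuousAt_rpow_const 0 _ (Or.inr (by linarith))
  have h3 := h2.tendsto.comp h1
  rwa [Function.comp_def, Real.zero_rpow (by linarith : (γ - 1 / 2 : ℝ) ≠ 0)] at h3

/-- **The Type-I constant tends to zero for a ratio pinned above `γ > ½`** (drifting-exponent form
of `eventually_sqrt_mul_norm_le_of_half_lt`): under the hypotheses of `speed_le_of_rescaling` with
`γ > ½`, for every `ε > 0`, eventually as `s ↑ T`, `√(T − s) F(s, x) ≤ ε` for all `x`. Leray 1934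
§19 (3.9) / the tree's `leray_blowup_rate_top` give the opposite inequality before a genuine
blow-up time. [cite: Hou2026, §3 (scaling formulas; blowup rates in the physical time variable)] -/
theorem eventually_sqrt_mul_speed_le_of_rescaling (hcu : Continuous cu) (hcl : Continuous cl)
    {a b : ℝ} (ha : 0 < a) (hca : ∀ s, 0 ≤ s → cu s ≤ -a) (hcb : ∀ s, 0 ≤ s → -b ≤ cu s)
    {γ : ℝ} (hγ : 1 / 2 < γ) (hratio : ∀ s, 0 ≤ s → γ * (-cu s) ≤ cl s)
    (hF0 : ∀ s x, 0 ≤ F s x)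
    (hF : ∀ τ, 0 ≤ τ → ∀ x, rescalingFactor cu τ / rescalingFactor (fun s => -cl s) τ *
      F (rescaledTime (rescalingFactor cu) τ) x ≤ M)
    {ε : ℝ} (hε : 0 < ε) :
    ∀ᶠ s in 𝓝[<] (blowupTime (rescalingFactor cu)), ∀ x,
      Real.sqrt (blowupTime (rescalingFactor cu) - s) * F s x ≤ ε := by
  set K : ℝ := M * (b ^ (γ - 1 / 2) * a ^ (-(1 / 2 : ℝ))) with hK
  have hT := blowupTime_pos (continuous_rescalingFactor hcu) (rescalingFactor_pos cu)
    (integrableOn_rescalingFactor hcu ha hca)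
  have hlim := (tendsto_rpow_sub_nhdsLT (T := blowupTime (rescalingFactor cu)) hγ).const_mul K
  rw [mul_zero] at hlim
  have hIoo : Ioo 0 (blowupTime (rescalingFactor cu)) ∈ 𝓝[<] (blowupTime (rescalingFactor cu)) :=
    Ioo_mem_nhdsLT hT
  filter_upwards [hlim.eventually_lt_const hε, hIoo] with s hs hsI x
  exact (sqrt_mul_speed_le_of_rescaling hcu hcl ha hca hcb hγ.le hratio hF0 hF ⟨hsI.1.le, hsI.2⟩
    x).trans hs.le

end Speed

/-! ### Leray's necessary rate excludes the sub-Leray side (composition with ns.S28) -/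

section Leray

variable {cu cl : ℝ → ℝ}

/-- **No Navier–Stokes blow-up is carried to its lifespan by a rescaling with ratio pinned above
`½` and bounded rescaled speed.** Let `ν > 0`, let the exponents be continuous with
`−b ≤ c_u ≤ −a < 0` and `γ (−c_u) ≤ c_l` on `[0, ∞)` for some `γ > ½`, and put `C_u, C_l, t, T`
as above. If `(u, p)` is a maximal smooth solution of the unforced system on `ℝ³ × [0, T)`
(`IsMaximalSmoothSolution ν 0 u p T`: classical on `[0, T)`, no smooth extension past `T`),
Leray–Hopf from `u 0`, whose rescaled speed is bounded, `(C_u/C_l)(τ) |u(t(τ), x)| ≤ M` for all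
`τ ≥ 0` and `x`, then `False`: by `speed_le_of_rescaling` the solution is essentially bounded on
every `[0, T'] × ℝ³`, `T' < T`, and `‖u(s)‖_∞ ≤ ε/√(T−s)` near `T` for every `ε > 0`, against
Leray's `c √ν/√(T − s) ≤ ‖u(s)‖_∞` on `[0, T)` (ns.S28, `leray_blowup_rate_top_holds`). Hence along
such a clock: either `limsup ‖ũ(τ)‖_∞ = ∞`, or the ratio is not eventually pinned above any
`γ > ½`, or `t(∞)` is not the lifespan. [cite: Leray1934, §19 (3.8)–(3.9) p. 224] -/
theorem not_isMaximalSmoothSolution_of_rescaling_of_half_lt {ν : ℝ} (hν : 0 < ν)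
    (hcu : Continuous cu) (hcl : Continuous cl) {a b : ℝ} (ha : 0 < a)
    (hca : ∀ s, 0 ≤ s → cu s ≤ -a) (hcb : ∀ s, 0 ≤ s → -b ≤ cu s) {γ : ℝ} (hγ : 1 / 2 < γ)
    (hratio : ∀ s, 0 ≤ s → γ * (-cu s) ≤ cl s)
    {u : ℝ → EuclideanSpace ℝ (Fin 3) → EuclideanSpace ℝ (Fin 3)}
    {p : ℝ → EuclideanSpace ℝ (Fin 3) → ℝ}
    (hmax : IsMaximalSmoothSolution ν 0 u p (blowupTime (rescalingFactor cu)))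
    (hLH : IsLerayHopfOn (blowupTime (rescalingFactor cu)) ν 0 (u 0) u) {M : ℝ}
    (hM : ∀ τ, 0 ≤ τ → ∀ x, rescalingFactor cu τ / rescalingFactor (fun s => -cl s) τ *
      ‖u (rescaledTime (rescalingFactor cu) τ) x‖ ≤ M) : False := by
  set T := blowupTime (rescalingFactor cu) with hTdef
  have hT : 0 < T := blowupTime_pos (continuous_rescalingFactor hcu) (rescalingFactor_pos cu)
    (integrableOn_rescalingFactor hcu ha hca)
  have hF0 : ∀ (s : ℝ) (x : EuclideanSpace ℝ (Fin 3)), 0 ≤ ‖u s x‖ := fun _ _ => norm_nonneg _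
  set K : ℝ := M * (b ^ (γ - 1 / 2) * a ^ (-(1 / 2 : ℝ))) with hK
  have hK0 : 0 ≤ K := by
    have h0 := hM 0 le_rfl 0
    have hM0 : 0 ≤ M := le_trans (mul_nonneg (div_pos (rescalingFactor_pos _ _)
      (rescalingFactor_pos _ _)).le (norm_nonneg _)) h0
    have hb : 0 < b := by
      have h1 := rescalingFactor_le_mul_sub_rescaledTime hcu ha hca hcb (le_refl (0 : ℝ))
      have hpos := rescalingFactor_pos cu 0
      have hd : 0 ≤ T - rescaledTime (rescalingFactor cu) 0 := by
        rw [rescaledTime_zero, sub_zero]; exact hT.le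
      exact pos_of_mul_pos_left (hpos.trans_le h1) hd
    exact mul_nonneg hM0 (mul_nonneg (Real.rpow_nonneg hb.le _) (Real.rpow_nonneg ha.le _))
  -- the pointwise envelope `‖u s x‖ ≤ K (T − s)^{γ−1}` on `[0, T)`
  have henv : ∀ s ∈ Ico 0 T, ∀ x, ‖u s x‖ ≤ K * (T - s) ^ (γ - 1) := fun s hs x =>
    speed_le_of_rescaling hcu hcl ha hca hcb hγ.le hratio hF0 hM hs x
  -- essential boundedness on the closed sub-slabs `[0, T'] × ℝ³`
  have hbdd : ∀ T' ∈ Ioo 0 T,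
      eLpNorm (uncurry u) ∞ (volume.restrict (Icc 0 T' ×ˢ univ)) < ∞ := by
    intro T' hT'
    have hTT' : 0 < T - T' := sub_pos.2 hT'.2
    rw [eLpNorm_exponent_top]
    refine eLpNormEssSup_lt_top_of_ae_bound
      (C := K * ((T - T') ^ (γ - 1) + T ^ (γ - 1))) ?_
    rw [ae_restrict_iff' (measurableSet_Icc.prod MeasurableSet.univ)]
    refine ae_of_all _ ?_
    rintro ⟨s, x⟩ ⟨hs, -⟩
    have hsT : s ∈ Ico 0 T := ⟨hs.1, hs.2.trans_lt hT'.2⟩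
    have hTs : 0 < T - s := sub_pos.2 hsT.2
    refine (henv s hsT x).trans (mul_le_mul_of_nonneg_left ?_ hK0)
    -- `(T−s)^{γ−1} ≤ (T−T')^{γ−1} + T^{γ−1}` whatever the sign of `γ − 1`
    rcases le_or_gt γ 1 with hγ1 | hγ1
    · have h1 : (T - s) ^ (γ - 1) ≤ (T - T') ^ (γ - 1) :=
        Real.rpow_le_rpow_of_nonpos hTT' (by linarith [hs.2]) (by linarith)
      linarith [Real.rpow_nonneg hT.le (γ - 1)]
    · have h1 : (T - s) ^ (γ - 1) ≤ T ^ (γ - 1) :=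
        Real.rpow_le_rpow hTs.le (by linarith [hs.1]) (by linarith)
      linarith [Real.rpow_nonneg hTT'.le (γ - 1)]
  -- Leray's rate from below
  obtain ⟨c, hc, hrate⟩ := leray_blowup_rate_top_holds
  have hcν : 0 < c * Real.sqrt ν := mul_pos hc (Real.sqrt_pos.2 hν)
  -- the sub-Leray bound from above, with `ε = c√ν/2`, at some `s ∈ (0, T)`
  have hev := eventually_sqrt_mul_speed_le_of_rescaling hcu hcl ha hca hcb hγ hratio hF0 hM
    (half_pos hcν)
  obtain ⟨s, hsε, hsI⟩ := (hev.and (Ioo_mem_nhdsLT hT)).exists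
  have hTs : 0 < T - s := sub_pos.2 hsI.2
  have hsq : 0 < Real.sqrt (T - s) := Real.sqrt_pos.2 hTs
  have hup : eLpNorm (u s) ∞ volume ≤ ENNReal.ofReal (c * Real.sqrt ν / 2 / Real.sqrt (T - s)) := by
    rw [eLpNorm_exponent_top]
    refine eLpNormEssSup_le_of_ae_bound (ae_of_all _ fun x => ?_)
    rw [le_div_iff₀ hsq, mul_comm]
    exact hsε x
  have hlow := hrate ν T hν hT u p hmax hLH hbdd s ⟨hsI.1.le, hsI.2⟩
  have h := (ENNReal.ofReal_le_ofReal_iff (by positivity)).1 (hlow.trans hup)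
  rw [div_le_div_iff_of_pos_right hsq] at h
  linarith

end Leray

end Literature.Analysis.FluidPDE

end
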